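import Mathlib
import HarnessLib
import Summits.HubbardSuperconductivity.HubbardSuperconductivity.Theorems.KLProgrammeKLRegimeEngineValueClausesV17FLadder
import Summits.HubbardSuperconductivity.HubbardSuperconductivity.Theorems.KLProgrammeKLRegimeSplitGeoRaise

/-!
# K3 ENGINE-FLOW child (gen 8, stmt-HubbardSuperconductivity-20437 `KLRegimeEngineV17F2`), stub (c) `stub_engine_step_values`:
# the VALUE-LANE clauses under a `CF`-IDLE package raise `G ↦ G.raise T E` with `T ≤ G.CF` — EQUALITIES, hypothesis side included
# (cell gate-hubbard-kl, seat hubbard-kl-k3c2-p2 g8; answer to plan g17 (R33)(ii), KL STATUS l.2751)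

(R33) re-keys the engine-flow render on 20437 from `klEngGeo6` to `klEngGeo7 := klEngGeo6.raise (klIsoT ^ 4) klE4T6` (k3c2-p1 g4's cE4-KEY cure:
only the `cE4` slot must grow).  `GeoConsts.raise T E` touches exactly two fields, `CF := max CF T` and `cE4 := max cE4 E`
(`…SplitGeoRaise`).  The value-lane clauses of the cured slot (`…SplitSlotsV17F`/`…SplitSlotsV17F2`) read `G` only through `initDevBar`,
`legDressBarQ2`, `bhi`, `klEdge`, `drivePBar`, `eremBar`, `gainBar`, `phGain` (all untouched by `raise`, `rfl`) and through `CF` — inside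
`thermalBar` ((E2-F2), (E2″-F), (E2′-F)) and in (E5-F)'s right-hand side `CF·B + CF·(Klam U)²`; NONE reads `cE4`.  Hence:

* §1 `GeoConsts.raise_CF_eq_of_le` (`T ≤ G.CF → (G.raise T E).CF = G.CF`), `thermalBar_raise_of_le` (equality), `legDressBarQ2_raise` (`rfl`);
* §2 UNCONDITIONAL conclusion-side lifts (any `T E`; `thermalBar`/`CF` monotone): `pairLadderStepAtV17F2_raise_of`, `pairValueIncrementAtV17F_raise_of`,
  `quarticValueIncrementAtV17F_raise_of`, `quarticValueUVAtV17F_raise_iff`, `isoTupleL1AtV17F_raise_of`, `betaSplitAtV17F_raise_iff` (`G` unread),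
  `twoLegReadJetsF_raise_iff` (`S` unread by `raise`), **`engineBoundsAtV17F2_raise_of`** (with (E4) by `engineFirstMoments_raise_of`, `0 ≤ Klam`);
* §3 under `T ≤ G.CF` the value clauses are EQUAL: `pairLadderStepAtV17F2_raise_iff_of_le`, `pairValueIncrementAtV17F_raise_iff_of_le`,
  `quarticValueIncrementAtV17F_raise_iff_of_le`, `isoTupleL1AtV17F_raise_iff_of_le` — so clauses taken on the HYPOTHESIS side (the (E2-F2)ₙ input `hlad`,
  the out-of-class rows `hout`, (E5-F)ₙ) transfer in BOTH directions;
* §4 the stub-(c) closers of `…ValueClausesV17FLadder` re-keyed at `klEngGeo6.raise T E` for ANY `T ≤ klEngGeo6.CF`, `E`: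
  `klg6r_package_ineq_of_isPairClassAt`, **`klvrF_stepValues_of_reduced_klEng6raise`**, **`klvrF_stepValues_of_reduced_klEng6raise_klEngU₀4`**
  (binder `U ≤ klEngU₀4 P R c`; `klEngU₀6 ≤ klEngU₀4` composes, `…DefsU6`), **`klg6rF_stepValues_of_signBlind_band`**.
  At `T := klIsoT ^ 4` (`klIsoT_pow_four_le_klEngGeo6_CF`, `…DefsG6Q6`) and `E := klE4T6` these ARE the `klEngGeo7` instances, by `rfl` on the (R33) definition.

Order lemmas / bookkeeping only; nothing about the model is asserted; nothing asserts superconductivity.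
-/

noncomputable section

namespace Summit.HubbardSuperconductivity.HubbardSuperconductivity.Theorems.KLRegimeSplit

set_option linter.dupNamespace false -- summit = problem name (single-conjunct summit), D-0017

open Real Finset Literature.MathematicalPhysics.QuantumLattice Literature.Probability.LatticeModels
open Summit.HubbardSuperconductivity.HubbardSuperconductivity.Theorems.KLProgrammeLegKernels
open Summit.HubbardSuperconductivity.HubbardSuperconductivity.Theorems.EngineV8

/-! ## §1 The two `CF`-readers under a `CF`-idle raise -/

/-- **A raise by `T ≤ G.CF` does not move `CF`.** -/
theorem GeoConsts.raise_CF_eq_of_le {G : GeoConsts} {T : ℝ} (h : T ≤ G.CF) (E : ℝ) : (G.raise T E).CF = G.CF := by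
  rw [GeoConsts.raise_CF]; exact max_eq_left h

/-- **`thermalBar` is unchanged by a `CF`-idle raise** (`T ≤ G.CF`). -/
theorem thermalBar_raise_of_le {G : GeoConsts} {T : ℝ} (h : T ≤ G.CF) (E : ℝ) (P : SplitConsts) (U β : ℝ) (n : ℕ) :
    thermalBar (G.raise T E) P U β n = thermalBar G P U β n := by
  unfold thermalBar; rw [GeoConsts.raise_CF_eq_of_le h]

/-- `legDressBarQ2` does not read `G`. -/
theorem legDressBarQ2_raise (G : GeoConsts) (T E : ℝ) (P : SplitConsts) (Q : EngConsts) (U : ℝ) (n c : ℕ) :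
    legDressBarQ2 (G.raise T E) P Q U n c = legDressBarQ2 G P Q U n c := rfl

section Model

variable {L M : ℕ} [NeZero L] [NeZero M] {G : GeoConsts} {P : SplitConsts} {Q : EngConsts} {R : RenConsts} {β U μ : ℝ} {n : ℕ}
variable (T E : ℝ)

/-! ## §2 Unconditional lifts `G → G.raise T E` of the value-lane clauses (conclusion side) -/

/-- **(E2-F2) lifts to `raise`**: scale-`0` clause unchanged (`initDevBar`, `legDressBarQ2`); the step clause's `bhi`, `klEdge`, array, `drivePBar`, `eremBar`,
`legDressBarQ2`, `phGain`, `frameShiftBar` are unchanged and `thermalBar` only grows. -/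
theorem pairLadderStepAtV17F2_raise_of (h : PairLadderStepAtV17F2 L M G P Q β U μ n) :
    PairLadderStepAtV17F2 L M (G.raise T E) P Q β U μ n := by
  obtain ⟨h0, hs⟩ := h
  refine ⟨fun hn Qm k hk k' hk' => ?_, fun hn Qm hQm => ?_⟩
  · rw [initDevBar_raise, legDressBarQ2_raise]
    exact h0 hn Qm k hk k' hk'
  · obtain ⟨w, hw1, hw2, N, hN, hb⟩ := hs hn Qm hQm
    refine ⟨w, hw1, ?_, N, hN, fun k hk k' hk' => (hb k hk k' hk').trans ?_⟩
    · rw [klEdge_raise]; exact hw2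
    · rw [drivePBar_raise, eremBar_raise, legDressBarQ2_raise, GeoConsts.raise_phGain]
      have := thermalBar_le_raise G T E P U β n
      linarith

/-- **(E2″-F) lifts to `raise`** (`gainBar`, `eremBar`, `legDressBarQ2`, `frameShiftBar` unchanged, `thermalBar` monotone). -/
theorem pairValueIncrementAtV17F_raise_of (h : PairValueIncrementAtV17F L M G P Q β U μ n) :
    PairValueIncrementAtV17F L M (G.raise T E) P Q β U μ n := by
  intro hn Qm k hk k' hk'
  refine (h hn Qm k hk k' hk').trans ?_
  rw [gainBar_raise, eremBar_raise, legDressBarQ2_raise]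
  have := thermalBar_le_raise G T E P U β n
  linarith

/-- **(E2′-F) lifts to `raise`.** -/
theorem quarticValueIncrementAtV17F_raise_of (h : QuarticValueIncrementAtV17F L M G P Q β U μ n) :
    QuarticValueIncrementAtV17F L M (G.raise T E) P Q β U μ n := by
  intro hn k₁ hk₁ k₂ hk₂ k₃ hk₃
  refine (h hn k₁ hk₁ k₂ hk₂ k₃ hk₃).trans ?_
  rw [gainBar_raise, eremBar_raise, legDressBarQ2_raise]
  have := thermalBar_le_raise G T E P U β n
  linarith

/-- **(E2′-F UV) is unchanged by `raise`** (reads `G` only through `initDevBar`, `legDressBarQ2`). -/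
theorem quarticValueUVAtV17F_raise_iff :
    QuarticValueUVAtV17F L M (G.raise T E) P Q β U μ n ↔ QuarticValueUVAtV17F L M G P Q β U μ n := by
  simp only [QuarticValueUVAtV17F, initDevBar_raise, legDressBarQ2_raise]

/-- **(E5-F) is monotone in `CF`.** -/
theorem isoTupleL1AtV17F_mono {G G' : GeoConsts} (hCF : G.CF ≤ G'.CF) (h : IsoTupleL1AtV17F L M G P β U μ n) :
    IsoTupleL1AtV17F L M G' P β U μ n := by
  intro B hB hval m hm Ω hΩ x₁
  refine (h B hB hval m hm Ω hΩ x₁).trans ?_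
  have h1 : 0 ≤ (P.Klam * U) ^ 2 := sq_nonneg _
  nlinarith

/-- **(E5-F) lifts to `raise`.** -/
theorem isoTupleL1AtV17F_raise_of (h : IsoTupleL1AtV17F L M G P β U μ n) : IsoTupleL1AtV17F L M (G.raise T E) P β U μ n :=
  isoTupleL1AtV17F_mono (G.CF_le_raise_CF T E) h

/-- **`BetaSplitAtV17F` does not read `G`.** -/
theorem betaSplitAtV17F_raise_iff : BetaSplitAtV17F L M (G.raise T E) P Q β U μ n ↔ BetaSplitAtV17F L M G P Q β U μ n := Iff.rfl

/-- **(E3a-F) `TwoLegReadJetsF` reads `G` only through `S`, untouched by `raise`.** -/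
theorem twoLegReadJetsF_raise_iff : TwoLegReadJetsF L M (G.raise T E) Q β U μ n ↔ TwoLegReadJetsF L M G Q β U μ n := Iff.rfl

/-- **The whole cured engine slot lifts to `raise`**: `EngineBoundsAtV17F2 … G … n → EngineBoundsAtV17F2 … (G.raise T E) … n` (`0 ≤ P.Klam` for (E4);
(E0) and (E1-v4) do not read `G`). -/
theorem engineBoundsAtV17F2_raise_of (hK : 0 ≤ P.Klam) (h : EngineBoundsAtV17F2 L M G P Q β U μ n) :
    EngineBoundsAtV17F2 L M (G.raise T E) P Q β U μ n := by
  obtain ⟨h0, h1, h2, h3, h4, h5, h6, h7⟩ := h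
  exact ⟨h0, h1, pairLadderStepAtV17F2_raise_of T E h2, pairValueIncrementAtV17F_raise_of T E h3, quarticValueIncrementAtV17F_raise_of T E h4,
    (quarticValueUVAtV17F_raise_iff T E).2 h5, engineFirstMoments_raise_of T E hK h6, isoTupleL1AtV17F_raise_of T E h7⟩

/-! ## §3 Under `T ≤ G.CF` the value clauses are EQUAL (both directions; hypothesis-side transfer) -/

variable {T}

/-- **(E2-F2) under a `CF`-idle raise is the same clause.** -/
theorem pairLadderStepAtV17F2_raise_iff_of_le (hT : T ≤ G.CF) :
    PairLadderStepAtV17F2 L M (G.raise T E) P Q β U μ n ↔ PairLadderStepAtV17F2 L M G P Q β U μ n := by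
  unfold PairLadderStepAtV17F2
  simp only [initDevBar_raise, legDressBarQ2_raise, GeoConsts.raise_bhi, klEdge_raise, drivePBar_raise, eremBar_raise,
    thermalBar_raise_of_le hT, GeoConsts.raise_phGain]

/-- **(E2″-F) under a `CF`-idle raise is the same clause.** -/
theorem pairValueIncrementAtV17F_raise_iff_of_le (hT : T ≤ G.CF) :
    PairValueIncrementAtV17F L M (G.raise T E) P Q β U μ n ↔ PairValueIncrementAtV17F L M G P Q β U μ n := by
  unfold PairValueIncrementAtV17F
  simp only [gainBar_raise, eremBar_raise, legDressBarQ2_raise, thermalBar_raise_of_le hT]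

/-- **(E2′-F) under a `CF`-idle raise is the same clause.** -/
theorem quarticValueIncrementAtV17F_raise_iff_of_le (hT : T ≤ G.CF) :
    QuarticValueIncrementAtV17F L M (G.raise T E) P Q β U μ n ↔ QuarticValueIncrementAtV17F L M G P Q β U μ n := by
  unfold QuarticValueIncrementAtV17F
  simp only [gainBar_raise, eremBar_raise, legDressBarQ2_raise, thermalBar_raise_of_le hT]

/-- **(E5-F) under a `CF`-idle raise is the same clause.** -/
theorem isoTupleL1AtV17F_raise_iff_of_le (hT : T ≤ G.CF) :
    IsoTupleL1AtV17F L M (G.raise T E) P β U μ n ↔ IsoTupleL1AtV17F L M G P β U μ n := by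
  unfold IsoTupleL1AtV17F
  simp only [GeoConsts.raise_CF_eq_of_le hT]

/-- **The out-of-class / in-class (E2″-F) ROW majorant under a `CF`-idle raise is the same number** (for the `hout`/`hin` hypotheses of the stub-(c) closers). -/
theorem pairValueRow_raise_eq_of_le (hT : T ≤ G.CF) (Qm k k' : TorusSite 2 L) :
    gainBar (G.raise T E) P U n (klTorusNorm L Qm) (klTorusNorm L (k - k')) (klTorusNorm L (k + k' - Qm)) +
          eremBar (G.raise T E) P Q U β L (n - 1) + thermalBar (G.raise T E) P U β n +
            legDressBarQ2 (G.raise T E) P Q U n (legSliceCountT L β μ (klFlowFrameU L M β U μ n) n ![k', Qm - k', Qm - k, k]) +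
              frameShiftBar P Q U n =
      gainBar G P U n (klTorusNorm L Qm) (klTorusNorm L (k - k')) (klTorusNorm L (k + k' - Qm)) +
          eremBar G P Q U β L (n - 1) + thermalBar G P U β n +
            legDressBarQ2 G P Q U n (legSliceCountT L β μ (klFlowFrameU L M β U μ n) n ![k', Qm - k', Qm - k, k]) +
              frameShiftBar P Q U n := by
  rw [gainBar_raise, eremBar_raise, legDressBarQ2_raise, thermalBar_raise_of_le hT]

/-! ## §4 The stub-(c) closers at `klEngGeo6.raise T E`, ANY `T ≤ klEngGeo6.CF` (⇒ the (R33) package `klEngGeo7` by `rfl`) -/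

omit [NeZero L] [NeZero M] in
/-- **The package line holds at `klEngGeo6.raise T E` in the pair class** (`aplus, ζ, bhi, ppGain` untouched by `raise`). -/
theorem klg6r_package_ineq_of_isPairClassAt (T E : ℝ) {Qm : TorusSite 2 L} (n : ℕ) (hQm : IsPairClassAt L Qm n) :
    (klEngGeo6.raise T E).aplus * (klEngGeo6.raise T E).ζ (n - 1) + 10 * (klEngGeo6.raise T E).bhi ≤
      (klEngGeo6.raise T E).ppGain n (klTorusNorm L Qm) :=
  klg6_package_ineq_of_isPairClassAt n hQm

/-- **The (c)-F value conjuncts from the REDUCED list at `(klEngGeo6.raise T E, Q)`**, any `T ≤ klEngGeo6.CF`, any `E`: the cured ladder clause (E2-F2)ₙ,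
the (B1-F) envelope at `n−1`, the OUT-OF-CLASS half of (E2″-F), (E5-F)ₙ and the two smallness lines — all read AT THE RAISED PACKAGE — give the four value
conjuncts at the raised package (transfer through §3's equalities to `klvrF_stepValues_of_reduced`). -/
theorem klvrF_stepValues_of_reduced_klEng6raise {T : ℝ} (hT : T ≤ klEngGeo6.CF) (E : ℝ) (hP : P.WF) (hQ : Q.WF) (hn : 1 ≤ n)
    (hlad : PairLadderStepAtV17F2 L M (klEngGeo6.raise T E) P Q β U μ n) (harr : PairArrayAtV17F L M P Q β U μ (n - 1))
    (hcU' : (P.C_W + klLegKappa * Q.CR * P.Klam ^ 3) * |U| ≤ 1 / 10) (hUb : |U| * (klEngGeo6.raise T E).bhi ≤ 1 / 8)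
    (hout : ∀ Qm : TorusSite 2 L, ¬ IsPairClassAt L Qm n → ∀ k ∈ klBall L μ 0, ∀ k' ∈ klBall L μ 0,
      ‖klPairAmplitude L M β U μ (klFlowFrameU L M β U μ n) n Qm k k' -
          klPairAmplitude L M β U μ (klFlowFrameU L M β U μ (n - 1)) (n - 1) Qm k k'‖ ≤
        gainBar (klEngGeo6.raise T E) P U n (klTorusNorm L Qm) (klTorusNorm L (k - k')) (klTorusNorm L (k + k' - Qm)) +
          eremBar (klEngGeo6.raise T E) P Q U β L (n - 1) + thermalBar (klEngGeo6.raise T E) P U β n +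
            legDressBarQ2 (klEngGeo6.raise T E) P Q U n (legSliceCountT L β μ (klFlowFrameU L M β U μ n) n ![k', Qm - k', Qm - k, k]) +
              frameShiftBar P Q U n)
    (hE5 : IsoTupleL1AtV17F L M (klEngGeo6.raise T E) P β U μ n) :
    PairLadderStepAtV17F2 L M (klEngGeo6.raise T E) P Q β U μ n ∧ PairValueIncrementAtV17F L M (klEngGeo6.raise T E) P Q β U μ n ∧
      QuarticValueIncrementAtV17F L M (klEngGeo6.raise T E) P Q β U μ n ∧ IsoTupleL1AtV17F L M (klEngGeo6.raise T E) P β U μ n := by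
  have hlad6 := (pairLadderStepAtV17F2_raise_iff_of_le (L := L) (M := M) (P := P) (Q := Q) (β := β) (U := U) (μ := μ) (n := n) E hT).1 hlad
  have hE56 := (isoTupleL1AtV17F_raise_iff_of_le (L := L) (M := M) (P := P) (β := β) (U := U) (μ := μ) (n := n) E hT).1 hE5
  have hUb6 : |U| * klEngGeo6.bhi ≤ 1 / 8 := by rwa [GeoConsts.raise_bhi] at hUb
  have hout6 : ∀ Qm : TorusSite 2 L, ¬ IsPairClassAt L Qm n → ∀ k ∈ klBall L μ 0, ∀ k' ∈ klBall L μ 0,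
      ‖klPairAmplitude L M β U μ (klFlowFrameU L M β U μ n) n Qm k k' -
          klPairAmplitude L M β U μ (klFlowFrameU L M β U μ (n - 1)) (n - 1) Qm k k'‖ ≤
        gainBar klEngGeo6 P U n (klTorusNorm L Qm) (klTorusNorm L (k - k')) (klTorusNorm L (k + k' - Qm)) +
          eremBar klEngGeo6 P Q U β L (n - 1) + thermalBar klEngGeo6 P U β n +
            legDressBarQ2 klEngGeo6 P Q U n (legSliceCountT L β μ (klFlowFrameU L M β U μ n) n ![k', Qm - k', Qm - k, k]) +
              frameShiftBar P Q U n := by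
    intro Qm hQm k hk k' hk'
    rw [← pairValueRow_raise_eq_of_le (L := L) (M := M) (P := P) (Q := Q) (β := β) (U := U) (μ := μ) (n := n) E hT Qm k k']
    exact hout Qm hQm k hk k' hk'
  obtain ⟨h1, h2, h3, h4⟩ := klvrF_stepValues_of_reduced hP hQ hn hlad6 harr hcU' hUb6 hout6 hE56
  exact ⟨(pairLadderStepAtV17F2_raise_iff_of_le E hT).2 h1, (pairValueIncrementAtV17F_raise_iff_of_le E hT).2 h2,
    (quarticValueIncrementAtV17F_raise_iff_of_le E hT).2 h3, (isoTupleL1AtV17F_raise_iff_of_le E hT).2 h4⟩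

/-- **Binder-keyed instance at `(klEngGeo6.raise T E, klEngQ6 P R)` under `0 < U ≤ klEngU₀4 P R c`** (any tighter threshold, e.g. `klEngU₀6 ≤ klEngU₀4`
of `…DefsU6`, composes by `le_trans`): the two smallness lines are discharged as in `klvrF_stepValues_of_reduced_klEngU₀4`. -/
theorem klvrF_stepValues_of_reduced_klEng6raise_klEngU₀4 {T : ℝ} (hT : T ≤ klEngGeo6.CF) (E : ℝ) (hP : P.WF) (hR : R.WF) {c : ℝ}
    (hU : 0 < U) (hU₀ : U ≤ klEngU₀4 P R c) (hn : 1 ≤ n)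
    (hlad : PairLadderStepAtV17F2 L M (klEngGeo6.raise T E) P (klEngQ6 P R) β U μ n)
    (harr : PairArrayAtV17F L M P (klEngQ6 P R) β U μ (n - 1))
    (hout : ∀ Qm : TorusSite 2 L, ¬ IsPairClassAt L Qm n → ∀ k ∈ klBall L μ 0, ∀ k' ∈ klBall L μ 0,
      ‖klPairAmplitude L M β U μ (klFlowFrameU L M β U μ n) n Qm k k' -
          klPairAmplitude L M β U μ (klFlowFrameU L M β U μ (n - 1)) (n - 1) Qm k k'‖ ≤
        gainBar (klEngGeo6.raise T E) P U n (klTorusNorm L Qm) (klTorusNorm L (k - k')) (klTorusNorm L (k + k' - Qm)) +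
          eremBar (klEngGeo6.raise T E) P (klEngQ6 P R) U β L (n - 1) + thermalBar (klEngGeo6.raise T E) P U β n +
            legDressBarQ2 (klEngGeo6.raise T E) P (klEngQ6 P R) U n
                (legSliceCountT L β μ (klFlowFrameU L M β U μ n) n ![k', Qm - k', Qm - k, k]) +
              frameShiftBar P (klEngQ6 P R) U n)
    (hE5 : IsoTupleL1AtV17F L M (klEngGeo6.raise T E) P β U μ n) :
    PairLadderStepAtV17F2 L M (klEngGeo6.raise T E) P (klEngQ6 P R) β U μ n ∧
      PairValueIncrementAtV17F L M (klEngGeo6.raise T E) P (klEngQ6 P R) β U μ n ∧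
        QuarticValueIncrementAtV17F L M (klEngGeo6.raise T E) P (klEngQ6 P R) β U μ n ∧
          IsoTupleL1AtV17F L M (klEngGeo6.raise T E) P β U μ n := by
  have hcU' : (P.C_W + klLegKappa * (klEngQ6 P R).CR * P.Klam ^ 3) * |U| ≤ 1 / 10 := by
    rw [klEngQ6_CR]; exact klEng_pairTolerance5_mul_le_of_le_klEngU₀4 hP hR hU hU₀
  have hUb : |U| * (klEngGeo6.raise T E).bhi ≤ 1 / 8 := by
    rw [GeoConsts.raise_bhi, klEngGeo6_bhi, klEngGeo5_bhi, klEngGeo4_bhi, klEngGeo3_bhi]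
    exact abs_mul_two_pow_24_le_of_le_klEngU₀4 hU hU₀
  exact klvrF_stepValues_of_reduced_klEng6raise hT E hP (klEngQ6_wf P R) hn hlad harr hcU' hUb hout hE5

/-- **The whole (c)-F conclusion in the thermal band at `(klEngGeo6.raise T E, Q)` from ONE sign-blind bound**, any `T ≤ klEngGeo6.CF`, any `E`:
`1 ≤ n`, `nScales β ≤ n + T'`, `‖𝒞_n[K_n] − 𝒞_{n−1}[K_{n−1}]‖ ≤ Cp·(Klam U)²` on the bare ball, `Cp·4^{T'} ≤ 2^80`, (E5-F)ₙ at the raised package. -/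
theorem klg6rF_stepValues_of_signBlind_band {T : ℝ} (hT : T ≤ klEngGeo6.CF) (E : ℝ) {T' : ℕ} {Cp : ℝ} (hP : P.WF) (hQ : Q.WF) (hn : 1 ≤ n)
    (hband : nScales β ≤ n + T') (hCp : 0 ≤ Cp) (hCpT : Cp * 4 ^ T' ≤ 2 ^ 80)
    (hpair : ∀ Qm : TorusSite 2 L, ∀ k ∈ klBall L μ 0, ∀ k' ∈ klBall L μ 0,
      ‖klPairAmplitude L M β U μ (klFlowFrameU L M β U μ n) n Qm k k' -
          klPairAmplitude L M β U μ (klFlowFrameU L M β U μ (n - 1)) (n - 1) Qm k k'‖ ≤ Cp * (P.Klam * U) ^ 2)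
    (hE5 : IsoTupleL1AtV17F L M (klEngGeo6.raise T E) P β U μ n) :
    PairLadderStepAtV17F2 L M (klEngGeo6.raise T E) P Q β U μ n ∧ PairValueIncrementAtV17F L M (klEngGeo6.raise T E) P Q β U μ n ∧
      QuarticValueIncrementAtV17F L M (klEngGeo6.raise T E) P Q β U μ n ∧ IsoTupleL1AtV17F L M (klEngGeo6.raise T E) P β U μ n := by
  have hE56 := (isoTupleL1AtV17F_raise_iff_of_le (L := L) (M := M) (P := P) (β := β) (U := U) (μ := μ) (n := n) E hT).1 hE5
  obtain ⟨h1, h2, h3, h4⟩ := klg6F_stepValues_of_signBlind_band (Q := Q) hP hQ hn hband hCp hCpT hpair hE56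
  exact ⟨(pairLadderStepAtV17F2_raise_iff_of_le E hT).2 h1, (pairValueIncrementAtV17F_raise_iff_of_le E hT).2 h2,
    (quarticValueIncrementAtV17F_raise_iff_of_le E hT).2 h3, hE5⟩

end Model

end Summit.HubbardSuperconductivity.HubbardSuperconductivity.Theorems.KLRegimeSplit

end
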